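import Literature.IUT.HodgeArakelov.AbsTopMonoidsGenuineZHatPow
import Literature.IUT.HodgeArakelov.AbsTopMonoidsGenuineIsometries
import Literature.AnabelianGeometry.AbsoluteAnabelian.GaloisPadicLogSeparated
import HarnessLib

/-!
# [IUTchII] Ex 1.8 (iv) / Rmk 1.11.1 (i)(b): the `Ẑ^×`-powers on `O^×(G)` INDUCE the `ℤ_p^×`-powers on `O^{×μ}(G)`
# at the genuine producers — `log_k̄(x^u) = χ_p(u) · log_k̄ x` (proof-only)

S. Mochizuki, *Inter-universal Teichmüller theory II*, §1, Example 1.8 (iv), kurims manuscript (Dec. 2020) p. 39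
[claim: Mochizuki2012, status: disputed] (IUTchII §1 Ex 1.8 (iv), kurims p.39): "`O^{×μ}(G)` is equipped with a
natural `Ẑ^×`-action, which factors through the quotient `Ẑ^× ↠ ℤ_p^×`. That is to say, `ℤ_p^×` acts naturally on
`O^{×μ}(G)`, hence maps to the group `Ism(G)`"; Remark 1.11.1 (i) (b) p. 50 ("the natural action of `Ẑ^×`" on
`O^×(G)`).  abc-iut cell, layer L6, MERGE-MAP row B9 (d) (units side × `O^{×μ}` side); row «ZHAT-COMPARE», seat
abc-iut-L6-d2 (gen 5).  PROOF-ONLY bridge between the two GENUINE `Ẑ^×`-actions now in the tree: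
abc-iut-w6-d010's `Genuine.zhatUnitAut C u = (x ↦ x^u)` on `𝒪_k̄^×` / `zhatPowOunits C` on `O^×(G) = (𝒪_k̄^⊳)ˣ`
(`AbsTopMonoidsGenuineZHatPow.lean`, p431139: THE equivariant automorphism with prescribed action on roots of unity,
abc-iut-L6-d1's `exists_equivariant_unitMulEquiv_of_compatible`) and this seat's `Genuine.zhatOxmu C u = (x ↦ x^{χ_p(u)})`
on `O^{×μ}(G)` (`AbsTopMonoidsGenuineIsometries.lean`, p427597: `MLFClosure.zpPow` through `log_k̄`).

* `Genuine.coe_zhatUnitAut_kummer` — the Kummer description of `x ↦ x^u` (abc-iut-L6-d1's third clause, by `rfl` on the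
  definition): `x^u = x^{χ_n(u)} · w^n` with `w ∈ k(x)`, for every `n ≥ 1`;
* **`Genuine.log_zhatUnitAut`** — `log_k̄(x^u) = χ_p(u) · log_k̄(x)`: the difference is `p^m · log_k̄(unit of k(x))` for
  every `m` (`χ_p(u) ≡ χ_{p^m}(u) mod p^m`, `ZHatLevel.toZModPow_padicChar`; the `ℤ_p`-lattice lemma
  `MLFClosure.exists_mem_adjoin_unit_log_eq_mul`), hence `0` by `p`-adic separatedness
  (`MLFClosure.eq_zero_of_forall_eq_pow_mul_log_adjoin`, p432836);
* **`Genuine.mk_zhatPowOunits`** — in `O^{×μ} = (𝒪_k̄^⊳)ˣ⧸μ`: `[x^u] = zhatOxmu u [x]`; and at the producer,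
  **`genuineOfModelIsm_actIsm_toIsm_mk`** — `Ẑ^× → Ism(G)` of `genuineOfModelIsm` IS the action induced on `O^{×μ}(G)` by
  the natural `Ẑ^×`-action `zhatPowOunits` on `O^×(G)` (the `zhatPow` datum of `Rmk1111_b` at the genuine producers).

HONEST FRAMING: record-only under a disputed claim key; classical (`p`-adic logarithm, Kummer theory, all inputs PROVED
in the tree); nothing here bears on [IUTchIII] Cor. 3.12.
-/

set_option autoImplicit false

noncomputable section

namespace Literature.IUT.HodgeArakelov

open CategoryTheory
open Literature.AnabelianGeometry.AbsoluteAnabelian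
open Literature.AnabelianGeometry.EtaleTheta

namespace AbsTopMonoids

namespace Genuine

variable (C : MLFClosure.{0})

/-- **Kummer description of `x ↦ x^u`** (abc-iut-L6-d1's third clause, definitionally attached to
`zhatUnitAut C u`): for every `n ≥ 1` there is `w ∈ k(x)`, `w ≠ 0`, with `x^u = x^{χ_n(u)} · w^n`.
[cite: MochizukiAbsTopIII2015, Proposition 3.3 (ii) p.74] -/
theorem coe_zhatUnitAut_kummer (u : ZHatUnits) (x : unitSubmonoid C.k C.K) (n : ℕ) (hn : 0 < n) :
    ∃ w ∈ IntermediateField.adjoin C.k ({(x : C.K)} : Set C.K), w ≠ 0 ∧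
      ((zhatUnitAut C u x : unitSubmonoid C.k C.K) : C.K) = (x : C.K) ^ levelExp u n * w ^ n :=
  (C.exists_equivariant_unitMulEquiv_of_compatible (levelExp u)
    (fun m n hm hn hmn => levelExp_modEq u m n hm hn hmn) (fun n hn => levelExp_coprime u n hn)).choose_spec.2.2
    x n hn

/-- Roots of units are units: if `w^n ∈ 𝒪_k̄^×` (`n ≥ 1`) then `w ∈ 𝒪_k̄^×` (`w = y₀ · ζ` with `y₀` a unit `n`-th root
of `w^n` and `ζ^n = 1`). [cite: MochizukiAbsTopIII2015, Definition 3.1 (i) p.66] -/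
theorem mem_unitSubmonoid_of_pow_mem {w : C.K} {n : ℕ} (hn : 0 < n) (hw : w ^ n ∈ unitSubmonoid C.k C.K) :
    w ∈ unitSubmonoid C.k C.K := by
  obtain ⟨y₀, hy₀U, hy₀⟩ := C.exists_unit_nthRoot hw hn
  have hy₀0 : y₀ ≠ 0 := ne_zero_of_mem_unitSubmonoid hy₀U
  have hζ : (w * y₀⁻¹) ^ n = 1 := by
    rw [mul_pow, inv_pow, hy₀, mul_inv_cancel₀ (pow_ne_zero n (ne_zero_of_mem_unitSubmonoid hw |> fun h => by
      intro hw0; exact h (by rw [hw0, zero_pow hn.ne'])))]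
  have hζU := C.mem_unitSubmonoid_of_pow_eq_one' (w * y₀⁻¹) n hn hζ
  have hw' : w = w * y₀⁻¹ * y₀ := by rw [inv_mul_cancel_right₀ hy₀0]
  rw [hw']
  exact (unitSubmonoid C.k C.K).mul_mem hζU hy₀U

variable [Fact C.residueChar.Prime]

/-- `χ_p(u) ≡ χ_{p^m}(u) (mod p^m)`: `χ_p(u) − levelExp u (p^m) ∈ p^m ℤ_p`.
[cite: MochizukiAbsTopIII2015, Proposition 3.3 (ii) p.74] -/
theorem exists_padicChar_sub_levelExp_eq (u : ZHatUnits) (m : ℕ) :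
    ∃ t : ℤ_[C.residueChar], ZHatLevel.padicChar C.residueChar u - (levelExp u (C.residueChar ^ m) : ℤ_[C.residueChar]) =
      t * (C.residueChar : ℤ_[C.residueChar]) ^ m := by
  have hpm : 0 < C.residueChar ^ m := pow_pos (Fact.out : C.residueChar.Prime).pos m
  haveI : NeZero (C.residueChar ^ m) := ⟨hpm.ne'⟩
  have hval : (((ZHatLevel.levelChar ⟨C.residueChar ^ m, hpm⟩ u).val : ℕ) : ZMod (C.residueChar ^ m)) =
      (ZHatLevel.levelChar (ZHatLevel.ppow C.residueChar m) u : ZMod (C.residueChar ^ m)) :=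
    ZMod.natCast_zmod_val (ZHatLevel.levelChar (ZHatLevel.ppow C.residueChar m) u)
  have hmem : ZHatLevel.padicChar C.residueChar u - (levelExp u (C.residueChar ^ m) : ℤ_[C.residueChar]) ∈
      RingHom.ker (PadicInt.toZModPow (p := C.residueChar) m) := by
    rw [RingHom.mem_ker, map_sub, map_natCast, ZHatLevel.toZModPow_padicChar, levelExp_of_pos u hpm, hval]
    exact sub_self _
  rw [PadicInt.ker_toZModPow, Ideal.mem_span_singleton'] at hmem
  obtain ⟨t, ht⟩ := hmem
  exact ⟨t, ht.symm⟩

/-- **`log_k̄(x^u) = χ_p(u) · log_k̄(x)` for `u ∈ Ẑ^×`, `x ∈ 𝒪_k̄^×`**: the `Ẑ^×`-power automorphism `zhatUnitAut C u` of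
`𝒪_k̄^×` acts on logarithms through the `p`-component `χ_p(u) ∈ ℤ_p^×`.  Proof: for every `m`,
`log(x^u) − χ_p(u)·log x = p^m · log_k̄(w · y_t⁻¹)` with `w, y_t` units of `k(x)` (Kummer description at `n = p^m`,
`χ_p(u) − χ_{p^m}(u) = t·p^m`, `log y_t = t·log x`), so it vanishes by `p`-adic separatedness of `log_k̄(𝒪_{k(x)}^×)`.
[claim: Mochizuki2012, status: disputed] (IUTchII §1 Ex 1.8 (iv), kurims p.39) -/
theorem log_zhatUnitAut (u : ZHatUnits) (x : unitSubmonoid C.k C.K) :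
    C.galoisPadicLog.log ((zhatUnitAut C u x : unitSubmonoid C.k C.K) : C.K) =
      C.padicScalar (ZHatLevel.padicChar C.residueChar u) * C.galoisPadicLog.log (x : C.K) := by
  have hp : 0 < C.residueChar := (Fact.out : C.residueChar.Prime).pos
  have hxU : (x : C.K) ∈ unitSubmonoid C.k C.K := x.2
  have hx0 : (x : C.K) ≠ 0 := ne_zero_of_mem_unitSubmonoid hxU
  have hβU : ((zhatUnitAut C u x : unitSubmonoid C.k C.K) : C.K) ∈ unitSubmonoid C.k C.K := (zhatUnitAut C u x).2
  rw [← sub_eq_zero]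
  apply C.eq_zero_of_forall_eq_pow_mul_log_adjoin (x : C.K)
  intro m
  have hpm : 0 < C.residueChar ^ m := pow_pos hp m
  obtain ⟨w, hwF, hw0, hβ⟩ := coe_zhatUnitAut_kummer C u x (C.residueChar ^ m) hpm
  -- `w` is a unit
  have hwnU : w ^ C.residueChar ^ m ∈ unitSubmonoid C.k C.K := by
    have h1 : w ^ C.residueChar ^ m =
        ((zhatUnitAut C u x : unitSubmonoid C.k C.K) : C.K) * ((x : C.K) ^ levelExp u (C.residueChar ^ m))⁻¹ := by
      rw [hβ, mul_comm ((x : C.K) ^ _), mul_assoc, mul_inv_cancel₀ (pow_ne_zero _ hx0), mul_one]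
    rw [h1]
    exact (unitSubmonoid C.k C.K).mul_mem hβU (inv_mem_unitSubmonoid (pow_mem hxU _))
  have hwU : w ∈ unitSubmonoid C.k C.K := mem_unitSubmonoid_of_pow_mem C hpm hwnU
  -- the congruence `χ_p(u) − a = t · p^m`
  obtain ⟨t, ht⟩ := exists_padicChar_sub_levelExp_eq C u m
  -- the lattice element `y_t ∈ k(x)`, `log y_t = t · log x`
  obtain ⟨yt, hytF, hytU, hyt⟩ := C.exists_mem_adjoin_unit_log_eq_mul hxU t
  rw [← MLFClosure.padicScalar_apply] at hyt
  have hyt0 : yt ≠ 0 := ne_zero_of_mem_unitSubmonoid hytU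
  refine ⟨w * yt⁻¹, ?_, (unitSubmonoid C.k C.K).mul_mem hwU (inv_mem_unitSubmonoid hytU), ?_⟩
  · exact mul_mem hwF (inv_mem hytF)
  -- logarithms
  have h1 : C.galoisPadicLog.log ((zhatUnitAut C u x : unitSubmonoid C.k C.K) : C.K) =
      (levelExp u (C.residueChar ^ m) : C.K) * C.galoisPadicLog.log (x : C.K) +
        ((C.residueChar : C.K) ^ m) * C.galoisPadicLog.log w := by
    rw [hβ, C.galoisPadicLog.log_mul _ (pow_mem hxU _) _ (pow_mem hwU _), C.galoisPadicLog.log_pow hxU,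
      C.galoisPadicLog.log_pow hwU, nsmul_eq_mul, nsmul_eq_mul, Nat.cast_pow]
  have h2 : C.padicScalar (ZHatLevel.padicChar C.residueChar u) =
      C.padicScalar t * (C.residueChar : C.K) ^ m + (levelExp u (C.residueChar ^ m) : C.K) := by
    have := congrArg C.padicScalar (eq_add_of_sub_eq ht)
    rw [map_add, map_mul, map_pow, map_natCast, map_natCast] at this
    exact this
  have hlog1 : C.galoisPadicLog.log (1 : C.K) = 0 :=
    C.galoisPadicLog.log_eq_zero_of_pow_eq_one (unitSubmonoid C.k C.K).one_mem one_pos (one_pow 1)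
  have h4 : C.galoisPadicLog.log yt⁻¹ = -C.galoisPadicLog.log yt := by
    have h := C.galoisPadicLog.log_mul _ hytU _ (inv_mem_unitSubmonoid hytU)
    rw [mul_inv_cancel₀ hyt0, hlog1] at h
    exact eq_neg_of_add_eq_zero_right h.symm
  have h5 : C.galoisPadicLog.log (w * yt⁻¹) = C.galoisPadicLog.log w + C.galoisPadicLog.log yt⁻¹ :=
    C.galoisPadicLog.log_mul _ hwU _ (inv_mem_unitSubmonoid hytU)
  rw [h5, h4, h1, h2, hyt]
  ring

/-- **In `O^{×μ} = (𝒪_k̄^⊳)ˣ⧸μ`: the class of `x^u` is `zhatOxmu u [x]`** — abc-iut-w6-d010's natural `Ẑ^×`-action on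
`O^×(G)` induces this seat's `ℤ_p^×`-action on `O^{×μ}(G)` ("which factors through `Ẑ^× ↠ ℤ_p^×`").
[claim: Mochizuki2012, status: disputed] (IUTchII §1 Ex 1.8 (iv), kurims p.39) -/
theorem mk_zhatPowOunits (u : ZHatUnits) (x : (nonzeroIntegers C.k C.K)ˣ) :
    (QuotientGroup.mk (zhatPowOunits C u x) : ModTorsion (nonzeroIntegers C.k C.K)ˣ) =
      zhatOxmu C u (QuotientGroup.mk x) := by
  apply (oxmuBridge C).injective
  apply C.logEquiv.injective
  apply Multiplicative.toAdd.injective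
  rw [toAdd_log_zhatOxmu, oxmuBridge_mk, oxmuBridge_mk, MLFClosure.logEquiv_mk, MLFClosure.logEquiv_mk,
    toAdd_ofAdd, toAdd_ofAdd, coe_unitsBridge, coe_unitsBridge, coe_zhatPowOunits]
  exact log_zhatUnitAut C u (ModelMLFGaloisData.unitsEquivUnitSubmonoid C x)

end Genuine

section Producer

open Genuine

variable (S : ThetaSetting.{0}) (C : MLFClosure.{0}) (ε : S.Gk ≃ₜ* (ModelMLFGaloisData.galois C.k C.K).tmPair.Pi)
  (hΔ : ∀ f : S.PiX ≃ₜ* S.PiX, S.DeltaX.map f.toMulEquiv.toMonoidHom = S.DeltaX)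
  (hq : Nonempty (TopGroup.quot S.PiX S.DeltaX ≃ₜ* S.Gk))

/-- **`Ẑ^× → Ism(G)` of the fully genuine producer IS induced by the natural `Ẑ^×`-action on `O^×(G)`**: for
`u ∈ Ẑ^×` and a unit `x ∈ O^×(G) = (𝒪_k̄^⊳)ˣ`, `toIsm(u) · [x] = [x^u]` with `x^u = zhatPowOunits C u x` (the `zhatPow`
datum of `Rmk1111_b` at the genuine producers, abc-iut-w6-d010).
[claim: Mochizuki2012, status: disputed] (IUTchII §1 Ex 1.8 (iv), kurims p.39) -/
theorem genuineOfModelIsm_actIsm_toIsm_mk (G : IsoClass S.Gk) (u : ZHatUnits)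
    (x : (genuineOfModelIsm S C ε hΔ hq).Ounits G) :
    (genuineOfModelIsm S C ε hΔ hq).actIsm G ((genuineOfModelIsm S C ε hΔ hq).toIsm G u) (QuotientGroup.mk x) =
      (QuotientGroup.mk (haveI := C.fact_residueChar_prime; Genuine.zhatPowOunits C u x) :
        (genuineOfModelIsm S C ε hΔ hq).Oxmu G) := by
  haveI := C.fact_residueChar_prime
  change zhatOxmu C u (QuotientGroup.mk x) = (QuotientGroup.mk (zhatPowOunits C u x) : ModTorsion (nonzeroIntegers C.k C.K)ˣ)
  exact (mk_zhatPowOunits C u x).symm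

end Producer

end AbsTopMonoids

end Literature.IUT.HodgeArakelov

end
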